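import Mathlib

/-!
# `GrenetZeon.DualUnipotentThreeHalves` (stmt-ValiantsHypothesis-24318), R2 heavy-top instrument — COROLLARY II port, step (c1):
# the THREE-LEVEL GRADED DIMENSION COUNT for a block upper-triangular space of matrices

For a level function `lvl : Fin m → ℕ` with values `≤ 2` and a linear space `V ≤ M_m(ℂ)` that is block upper-triangular in the convention of
✓ `HeavyTopCompositionBlocks.exists_block_conj` (`A i j = 0` whenever `lvl i < lvl j`), if the three re-indexed diagonal blocks of every
member of `V` lie in given spaces `W₀ ≤ M_{s₀}(ℂ)`, `W₁ ≤ M_{s₁}(ℂ)`, `W₂ ≤ M_{s₂}(ℂ)`, then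

`dim V ≤ dim W₀ + dim W₁ + dim W₂ + #{(i, j) : lvl j < lvl i}`

(rank–nullity for the diagonal-block map `V → W₀ × W₁ × W₂`, whose kernel injects into the functions on the strict pattern).  Stated without
definitions (the spaces `W_t` and the re-indexings `e_t` are hypotheses), so that the classification (crux note `CENSUS-THMC-UNIFORM-eng1g5.md` §8,
composition-chain route) can apply it to COARSENINGS of a composition chain (levels below / at / above one irreducible block), nested once for
two `3`-blocks, together with the deficiency table ✓ `…HeavyTopCodimOneBlocks` and the Gerstenhaber bound on the coarse blocks.

* `entry_eq_zero_of_blocks_eq_zero` — a block upper-triangular matrix with vanishing diagonal blocks is supported on the strict pattern;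
* ★ `finrank_le_of_three_levels` — the count.

Honest framing: linear algebra; nothing here proves or refutes `HeavyTopLaw`, 24318, S3b or 8062; `VP ≠ VNP` is NOT proved.  No definitions.
[folklore (graded rank–nullity); cell val-heavytop-census, eng-1 g5]
-/

noncomputable section

-- single-conjunct layout: Sub = Summit, duplicated namespace component intended
set_option linter.dupNamespace false

namespace Summit.ValiantsHypothesis.ValiantsHypothesis.Theorems.GrenetZeon.HeavyTopCodimOneCount

open Matrix

/-- An entry of a re-indexed diagonal block. -/
theorem reindex_toBlock_apply {m s t : ℕ} (lvl : Fin m → ℕ) (e : {i : Fin m // lvl i = t} ≃ Fin s) (A : Matrix (Fin m) (Fin m) ℂ)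
    (i j : Fin m) (hi : lvl i = t) (hj : lvl j = t) :
    Matrix.reindex e e (A.toBlock (fun i => lvl i = t) (fun i => lvl i = t)) (e ⟨i, hi⟩) (e ⟨j, hj⟩) = A i j := by
  rw [Matrix.reindex_apply, Matrix.submatrix_apply, Equiv.symm_apply_apply, Equiv.symm_apply_apply, Matrix.toBlock_apply]

/-- A block upper-triangular matrix (levels `≤ 2`) whose three re-indexed diagonal blocks vanish is supported on the strict pattern `lvl j < lvl i`. -/
theorem entry_eq_zero_of_blocks_eq_zero {m s₀ s₁ s₂ : ℕ} (lvl : Fin m → ℕ) (hlvl : ∀ i, lvl i ≤ 2)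
    (e₀ : {i : Fin m // lvl i = 0} ≃ Fin s₀) (e₁ : {i : Fin m // lvl i = 1} ≃ Fin s₁) (e₂ : {i : Fin m // lvl i = 2} ≃ Fin s₂)
    (A : Matrix (Fin m) (Fin m) ℂ) (hblock : ∀ i j, lvl i < lvl j → A i j = 0)
    (h₀ : Matrix.reindex e₀ e₀ (A.toBlock (fun i => lvl i = 0) (fun i => lvl i = 0)) = 0)
    (h₁ : Matrix.reindex e₁ e₁ (A.toBlock (fun i => lvl i = 1) (fun i => lvl i = 1)) = 0)
    (h₂ : Matrix.reindex e₂ e₂ (A.toBlock (fun i => lvl i = 2) (fun i => lvl i = 2)) = 0)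
    (i j : Fin m) (hij : ¬ lvl j < lvl i) : A i j = 0 := by
  rcases lt_or_eq_of_le (not_lt.1 hij) with hlt | heq
  · exact hblock i j hlt
  · obtain h | h | h : lvl i = 0 ∨ lvl i = 1 ∨ lvl i = 2 := by have := hlvl i; omega
    · rw [← reindex_toBlock_apply lvl e₀ A i j h (heq ▸ h), h₀, Matrix.zero_apply]
    · rw [← reindex_toBlock_apply lvl e₁ A i j h (heq ▸ h), h₁, Matrix.zero_apply]
    · rw [← reindex_toBlock_apply lvl e₂ A i j h (heq ▸ h), h₂, Matrix.zero_apply]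

/-- ★ **Three-level graded count.**  `dim V ≤ dim W₀ + dim W₁ + dim W₂ + #{(i, j) : lvl j < lvl i}` for a block upper-triangular `V`
(`A i j = 0` for `lvl i < lvl j`, levels `≤ 2`) whose re-indexed diagonal blocks lie in `W₀`, `W₁`, `W₂`. [folklore] -/
theorem finrank_le_of_three_levels {m s₀ s₁ s₂ : ℕ} (lvl : Fin m → ℕ) (hlvl : ∀ i, lvl i ≤ 2)
    (e₀ : {i : Fin m // lvl i = 0} ≃ Fin s₀) (e₁ : {i : Fin m // lvl i = 1} ≃ Fin s₁) (e₂ : {i : Fin m // lvl i = 2} ≃ Fin s₂)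
    (V : Submodule ℂ (Matrix (Fin m) (Fin m) ℂ)) (hblock : ∀ A ∈ V, ∀ i j, lvl i < lvl j → A i j = 0)
    (W₀ : Submodule ℂ (Matrix (Fin s₀) (Fin s₀) ℂ)) (W₁ : Submodule ℂ (Matrix (Fin s₁) (Fin s₁) ℂ))
    (W₂ : Submodule ℂ (Matrix (Fin s₂) (Fin s₂) ℂ))
    (h₀ : ∀ A ∈ V, Matrix.reindex e₀ e₀ (A.toBlock (fun i => lvl i = 0) (fun i => lvl i = 0)) ∈ W₀)
    (h₁ : ∀ A ∈ V, Matrix.reindex e₁ e₁ (A.toBlock (fun i => lvl i = 1) (fun i => lvl i = 1)) ∈ W₁)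
    (h₂ : ∀ A ∈ V, Matrix.reindex e₂ e₂ (A.toBlock (fun i => lvl i = 2) (fun i => lvl i = 2)) ∈ W₂) :
    Module.finrank ℂ V ≤ Module.finrank ℂ W₀ + Module.finrank ℂ W₁ + Module.finrank ℂ W₂ +
      Fintype.card {x : Fin m × Fin m // lvl x.2 < lvl x.1} := by
  classical
  -- the diagonal-block map
  let D : V →ₗ[ℂ] (W₀ × W₁) × W₂ :=
    { toFun := fun A =>
        ((⟨Matrix.reindex e₀ e₀ ((A : Matrix (Fin m) (Fin m) ℂ).toBlock (fun i => lvl i = 0) (fun i => lvl i = 0)), h₀ A A.2⟩,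
          ⟨Matrix.reindex e₁ e₁ ((A : Matrix (Fin m) (Fin m) ℂ).toBlock (fun i => lvl i = 1) (fun i => lvl i = 1)), h₁ A A.2⟩),
          ⟨Matrix.reindex e₂ e₂ ((A : Matrix (Fin m) (Fin m) ℂ).toBlock (fun i => lvl i = 2) (fun i => lvl i = 2)), h₂ A A.2⟩)
      map_add' := fun A B => by
        refine Prod.ext (Prod.ext (Subtype.ext ?_) (Subtype.ext ?_)) (Subtype.ext ?_) <;> ext a b <;> rfl
      map_smul' := fun c A => by
        refine Prod.ext (Prod.ext (Subtype.ext ?_) (Subtype.ext ?_)) (Subtype.ext ?_) <;> ext a b <;> rfl }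
  -- kernel members are supported on the strict pattern
  have hker : ∀ A : V, D A = 0 → ∀ i j, ¬ lvl j < lvl i → (A : Matrix (Fin m) (Fin m) ℂ) i j = 0 := by
    intro A hA
    have g₀ := congrArg (fun x => ((x.1.1 : W₀) : Matrix (Fin s₀) (Fin s₀) ℂ)) hA
    have g₁ := congrArg (fun x => ((x.1.2 : W₁) : Matrix (Fin s₁) (Fin s₁) ℂ)) hA
    have g₂ := congrArg (fun x => ((x.2 : W₂) : Matrix (Fin s₂) (Fin s₂) ℂ)) hA
    exact entry_eq_zero_of_blocks_eq_zero lvl hlvl e₀ e₁ e₂ A (hblock A A.2) g₀ g₁ g₂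
  -- the kernel injects into the functions on the strict pattern
  let F : LinearMap.ker D →ₗ[ℂ] ({x : Fin m × Fin m // lvl x.2 < lvl x.1} → ℂ) :=
    { toFun := fun A x => ((A : V) : Matrix (Fin m) (Fin m) ℂ) x.1.1 x.1.2
      map_add' := fun A B => by funext x; rfl
      map_smul' := fun c A => by funext x; rfl }
  have hF : Function.Injective F := by
    intro A B hAB
    apply Subtype.ext
    apply Subtype.ext
    ext i j
    by_cases hij : lvl j < lvl i
    · exact congrFun hAB ⟨(i, j), hij⟩
    · rw [hker A.1 (LinearMap.mem_ker.1 A.2) i j hij, hker B.1 (LinearMap.mem_ker.1 B.2) i j hij]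
  have h1 := LinearMap.finrank_range_add_finrank_ker D
  have h2 : Module.finrank ℂ (LinearMap.range D) ≤ Module.finrank ℂ ((W₀ × W₁) × W₂) := Submodule.finrank_le _
  have h3 := LinearMap.finrank_le_finrank_of_injective hF
  rw [Module.finrank_fintype_fun_eq_card] at h3
  rw [Module.finrank_prod, Module.finrank_prod] at h2
  omega

end Summit.ValiantsHypothesis.ValiantsHypothesis.Theorems.GrenetZeon.HeavyTopCodimOneCount

end
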